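import Summits.QuantumFields.YangMills.Theorems.UnitScaleTiltProp7CornerCombGaugeRowFolded
import Summits.QuantumFields.YangMills.Theorems.UnitScaleTiltProp7CornerCombLinesInhabited
import Summits.QuantumFields.YangMills.Theorems.UnitScaleTiltProp7CornerCombCellTheoremMember
import HarnessLib

/-!
# Route `UnitScaleTilt`, crux K1 «MinimiserStabilityRegPr» (stmt-QuantumFields-19200), route-R E′ (A′)-on-Σ, P-A2 (β), row «(n3)-comb» `hMcomb` —
# lane (II) file F-8b-5b-1 «THE GAUGE ROW INHABITED AT THE TOWER»: F-8b-4 v2's displayed scalar gauge row `hrow` — `λ_j² ≤ Σ_{i<j} (ρ⁻¹)^{j−i}·(wG·g_i² + wN·n_i² + wM_i·(m_i²+n_i²)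
# + wS·σ_i²·(m_i+n_i+λ_i)²)` — PROVED for the comb tower over the member's averaged backgrounds `Ūʲ = avgIter L U₀ j` (matrix algebra `M_N(ℂ)`), from ✓F-8b-5b-0 `…GaugeRowFolded` (= ✓F-6d-3′ Σ over corners,
# window-restricted ∘ ✓F-8b-5a the gauge row kernel) + ✓F-8b-2 v2 (the lines inhabited: gradient of the split, mass of the split, the DEF slot) + ✓F-8b-1 (periodic families).

Cell `ym3-torus` (HUMAN RULING D-0037: YM₃ on the torus is ladder rung R3 — not d = 4, not a mass gap, not Clay), D-0154 (3c) R3 twin-width seat `ym-routeR-w6` (gen 9);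
★routeR-w1 g10 PEN-NAMER WORD 2026-08-29 12:17:24Z∕12:18:49Z «F-8b-5b → routeR-w6 g9» and the split word 12:19:23Z (5b-1 here; 5b-2 «THE CLOSED CELL THEOREM» = w3-19200 g14:
F-8b-4 v2 ∘ this file).  DESIGN = w5-19200 g8's `HANDOFF-F8b-w5g8.md` §«THE LAST FILE» (periodicity bookkeeping imported BY NAME from their ✓p719061 F-8b-4 v2 `…CornerCombCellTheoremMember`).
`--supports stmt-QuantumFields-19200 --as helper`; THEOREMS ONLY (0 `def`, 0 `sorry`); count-neutral.  «(O2) groundwork — route-internal row (n3)-comb, NOT N06, NOT a print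
row; OPEN».  Nothing of `hMcomb`, `hMcomb₂`, (β), `hPA2`, `hcoS`, E′, EX, the stub, the crux, d = 4 or the gap is claimed.

THE MATHEMATICS (Bałaban [Balaban1987RG1] (0.1)∕(0.4) pp.251–253 — the gauge part `Λ` of the linearised fluctuation field is driven by the corner charges of the reduced family;
[Balaban1985Averaging] Prop. 3 (122)–(126) p.36).  DATA: an `N′Lᵏ`-periodic tower `U₀, U₁ : ℤᵈ → M_N(ℂ)ˣ` with unitary averaged backgrounds `Ūʲ` (`j ≤ k`), small `L`-loops
(`α_j ≤ 1∕24`), plaquettes (`a_j`), two-block walk masses (`μ_j`, `72μ_j ≤ 1`) below the top; the sourceless∕sourced reduced families `G^{lin}`, `N` with source `rem` and the gauge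
family `Λ` (✓F-7a∕F-8b-1 letters); the cell letters `m n g λ` (cell `√Σ`'s over `{boxVec (N′L^{k−j}) t}`).  CLAIM (`hrow` of F-8b-4 v2, VERBATIM): for `j ≤ k`,
`λ_j² ≤ Σ_{i ∈ range j} (ρ⁻¹)^{j−i}·(wG·g_i² + wN·n_i² + wM_i·(m_i² + n_i²) + wS·(260μ_i(2d+2)L√(2d))²·(m_i + n_i + λ_i)²)` — GIVEN `√L = ρ⁻¹` (on `T³`: `ρ = √(L²∕L³)`), the cube
letters `L² + L ≤ nC + 1 ≤ AC·L²` of ✓F-6d-3, and four DOMINATIONS of the free weights by ✓F-8b-5a's closed kernel coefficients `Γc, Μc_i, Δc` (displayed in the statement):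
`2Γc ≤ wG`, `8dΓc ≤ wN`, `2Μc_i + 4Δc·(210(2d+2)L)²α_i²(2d) ≤ wM_i` (`i < k`), `2Δc ≤ wS` (weights `wG wN wM_i ≥ 0` as in F-8b-4; `Δc ≥ 0` by hand).
PROOF.  `j = 0`: `Λ_0 = 0`.  `j = k′+1 ≤ k`: ✓F-8b-5b-0 `…GaugeRowFolded.gauge_row_folded` at `V i := Ūⁱ` (unitary ⇒ `U1`, periodic by ✓F-8a), `G := G̃ = G^{lin} + N` (periodic by
✓F-8b-1 `isPeriodic_sourced_families`), the genuine `Λ`, periods `Nc i := N′L^{k−i}`, bond–segment window `δ_j := 4α_j` (lit ✓`norm_bavg_sub_straight_le`), loop windows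
`wq := α`, `V̄_{k′}(L•z,κ) = Ū^{k′+1}(z,κ)` unitary; then termwise ✓F-8b-2 v2 on the written-out cell energies `Γ_i := GRADc_i(G̃)`, `Μ_i := MASSc_i(G̃)`, `Δ_i := DEFc_i`: `Γ_i ≤ 2g_i² + 8d·n_i²` (`sum_cell_covGrad_add_le`), `Μ_i ≤ 2m_i² + 2n_i²`,
`Δ_i ≤ 2(210(2d+2)L)²α_i²(2d)·Μ_i + 2(260μ_i)²((2d+2)L)²(2d)·MASS_i(Ỹ)` (§5 `sum_cell_stepDefect_sq_le`), `MASS_i(Ỹ) ≤ (m_i+n_i+λ_i)²` (✓F-7a structure + `sqrt_mass_full_le`);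
the dominations close each summand, `(√L)^{k′+1−i} = (ρ⁻¹)^{k′+1−i}`.

WHAT IS PROVED (ns `…Theorems.Prop7CornerCombGaugeRowInhabited`): ★★★ `gauge_row_inhabited` (binders = a SUB-LIST of F-8b-4 v2 `sum_cell_normSq_tild_le_two_slot`'s at
`𝔸 := Matrix (Fin N) (Fin N) ℂ`, `hL : 2 ≤ L` replacing `1 ≤ L`, incl. `hwG hwN hwM0`, PLUS `nC AC hnC hnA hρs hdomG hdomN hdomM hdomS`; conclusion = the `hrow` binder text).
HONEST SCOPE.  A composition of landed rows; the weights stay free (the consumer — F-8c-final-2 — picks them at the dominations and checks F-8b-4's smallness); rung R3, not Clay;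
YM gap NOT proved.

References: T. Bałaban, CMP **109** (1987) 249–301 [Balaban1987RG1] ((0.1), (0.4) pp.251–253); CMP **98** (1985) 17–51 [Balaban1985Averaging] ((2) p.17, (42)–(47) pp.23–25,
(68)–(69) p.29, (112) p.34, (119)–(126) pp.35–36); CMP **95** (1984) 17–40 [Balaban1984PropagatorsI] ((1.18)–(1.20) pp.19–20).
-/

set_option autoImplicit false

noncomputable section

open scoped BigOperators Matrix.Norms.L2Operator

namespace Summit.QuantumFields.YangMills.Theorems.Prop7CornerCombGaugeRowInhabited

open Finset
open Literature.MathematicalPhysics.QuantumFieldTheory.Balaban1983to89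
open ExpMeanLog (eml)
open B7Prop1Explicit (Site Letter e hol seg treeWord boxVec gammaWord plaqWord Wcx Xavg bavg expUnit U1)
open B7Prop2Explicit (avgIter avgIter_succ rescale_apply unitaryUnits unitaryUnits_le_U1)
open B7Eq92Concrete (tildIter)
open B7Eq78Linearization (conjR)
open B7Prop3GeneralRotated (tsum)
open B7Prop3GeneralLinear (FhatCov)
open T4TermwiseTorus (IsPeriodic)
open B7Eq47AveragedBondVsStraight (norm_bavg_sub_straight_le)
open Summit.QuantumFields.YangMills.Theorems.Prop7CornerCombSourcedStructure (sourced_cornerComb_structure)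
open Summit.QuantumFields.YangMills.Theorems.Prop7CornerCombFamiliesPeriodic (isPeriodic_sourced_families apply_add_period_of_isPeriodic period_tower_step
  exists_gauge_family cornerCharge_add sourced_recursion_of_split)
open Summit.QuantumFields.YangMills.Theorems.Prop7CornerCombLinesInhabited (sum_cell_covGrad_add_le sum_cell_stepDefect_sq_le sqrt_mass_full_le)
open Summit.QuantumFields.YangMills.Theorems.Prop7CornerCombGaugeRowKernel (cL_nonneg)
open Summit.QuantumFields.YangMills.Theorems.Prop7CornerCombGaugeRowFolded (gauge_row_folded)
open Summit.QuantumFields.YangMills.Theorems.Prop7CornerCombCellTheoremMember (sum_boxVec_congr rem_isPeriodic tildField_isPeriodic avgIter_isPeriodic_level)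

variable {d : ℕ}

/-! ## §1 The summand algebra (pure real arithmetic) -/

/-- One level of the kernel sum against one level of the displayed row: the three cell energies bounded by the letters, the free weights dominating the kernel
coefficients.  Only the sign of the DEF coefficient `Δc` is used (the `Γ`- and `Μ`-coefficients may have any sign: case split against `wG, wN, wM ≥ 0`). [folklore] -/
theorem summand_le {Γc Μc Δc Γ Μ Δ MY gg nn mm P Kα Sσ dd wG wN wMi wS : ℝ} (hwG : 0 ≤ wG) (hwN : 0 ≤ wN) (hwM : 0 ≤ wMi) (hΔc : 0 ≤ Δc)
    (hS : 0 ≤ Sσ) (hgg : 0 ≤ gg) (hnn : 0 ≤ nn) (hΓp : 0 ≤ Γ) (hΜp : 0 ≤ Μ) (hMYp : 0 ≤ MY)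
    (hΓ : Γ ≤ 2 * gg + dd * nn) (hΜ : Μ ≤ 2 * mm + 2 * nn) (hΔ : Δ ≤ 2 * (Kα * Μ) + 2 * (Sσ * MY)) (hMY : MY ≤ P)
    (hdG : 2 * Γc ≤ wG) (hdN : dd * Γc ≤ wN) (hdM : 2 * Μc + 4 * Δc * Kα ≤ wMi) (hdS : 2 * Δc ≤ wS) :
    Γc * Γ + Μc * Μ + Δc * Δ ≤ wG * gg + wN * nn + wMi * (mm + nn) + wS * Sσ * P := by
  have hΓpart : Γc * Γ ≤ wG * gg + wN * nn := by
    rcases le_or_gt 0 Γc with h | h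
    · calc Γc * Γ ≤ Γc * (2 * gg + dd * nn) := mul_le_mul_of_nonneg_left hΓ h
        _ = 2 * Γc * gg + dd * Γc * nn := by ring
        _ ≤ wG * gg + wN * nn := add_le_add (mul_le_mul_of_nonneg_right hdG hgg) (mul_le_mul_of_nonneg_right hdN hnn)
    · have h1 : 0 ≤ -Γc * Γ := mul_nonneg (by linarith) hΓp
      nlinarith [mul_nonneg hwG hgg, mul_nonneg hwN hnn]
  have hΔpart : Δc * Δ ≤ 2 * Δc * Kα * Μ + wS * (Sσ * MY) :=
    calc Δc * Δ ≤ Δc * (2 * (Kα * Μ) + 2 * (Sσ * MY)) := mul_le_mul_of_nonneg_left hΔ hΔc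
      _ = 2 * Δc * Kα * Μ + 2 * Δc * (Sσ * MY) := by ring
      _ ≤ 2 * Δc * Kα * Μ + wS * (Sσ * MY) := by
          have := mul_le_mul_of_nonneg_right hdS (mul_nonneg hS hMYp); linarith
  have hΜpart : (Μc + 2 * Δc * Kα) * Μ ≤ wMi / 2 * Μ := mul_le_mul_of_nonneg_right (by linarith) hΜp
  have hΜ' : wMi / 2 * Μ ≤ wMi / 2 * (2 * mm + 2 * nn) := mul_le_mul_of_nonneg_left hΜ (by linarith)
  have hY' : wS * (Sσ * MY) ≤ wS * (Sσ * P) :=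
    mul_le_mul_of_nonneg_left (mul_le_mul_of_nonneg_left hMY hS) (le_trans (by linarith) hdS)
  nlinarith [hΓpart, hΔpart, hΜpart, hΜ', hY']

/-! ## §2 ★★★ The gauge row inhabited at the tower -/

variable {N : ℕ} [NeZero N]

set_option maxHeartbeats 400000 in
/-- ★★★ **THE GAUGE ROW INHABITED AT THE TOWER** (F-8b-4 v2's displayed `hrow`, proved at `𝔸 := M_N(ℂ)`).  See the module docstring for the data and the proof.  The binders up to
`hlam` are a sub-list of F-8b-4 v2 `…CornerCombCellTheoremMember.sum_cell_normSq_tild_le_two_slot`'s (with `hL : 2 ≤ L`); the extras are the cube letters `nC AC` of ✓F-6d-3, the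
`T³` slot `√L = ρ⁻¹`, and the four dominations of the free weights `wG wN wM wS` (`wG wN wM ≥ 0`) by ✓F-8b-5a's kernel coefficients.  CONCLUSION = the `hrow` binder text.
(Decl-local heartbeat budget 400000: the one application of ✓F-8b-5b-0 `gauge_row_folded` instantiates a 4 000-token statement at the tower's lambdas over a 45-binder
context; measured 100 000 < cost < 130 000 at the time of filing — under the default, the budget line is head-room per the cell's README rule, not a requirement.)
[cite: Balaban1987RG1, (0.1), (0.4) pp.251–253; Balaban1985Averaging, Prop. 3 (122)–(126) p.36, (68)–(69) p.29] -/
theorem gauge_row_inhabited (L N' k : ℕ) (hL : 2 ≤ L) (hN' : 0 < N') (U₀ U₁ : Site d → Fin d → (Matrix (Fin N) (Fin N) ℂ)ˣ)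
    (hU₀ : IsPeriodic (N' * L ^ k) U₀) (hU₁ : IsPeriodic (N' * L ^ k) U₁)
    (hVu : ∀ j ≤ k, ∀ x μ, avgIter L U₀ j x μ ∈ unitaryUnits (Matrix (Fin N) (Fin N) ℂ))
    (hTu : ∀ j < k, ∀ x μ, tildIter L U₀ U₁ j x μ ∈ U1 (Matrix (Fin N) (Fin N) ℂ))
    (α a μ : ℕ → ℝ) (hα0 : ∀ j, 0 ≤ α j) (hα24 : ∀ j < k, α j ≤ 1 / 24)
    (hα : ∀ j < k, ∀ (z : Site d) (κ : Fin d) (r : Fin d → Fin L),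
      ‖((Wcx L (avgIter L U₀ j) ((L : ℤ) • z) κ (boxVec L r) : (Matrix (Fin N) (Fin N) ℂ)ˣ) : Matrix (Fin N) (Fin N) ℂ) - 1‖ ≤ α j)
    (ha0 : ∀ j, 0 ≤ a j)
    (hplaq : ∀ j < k, ∀ (x : Site d) (κ' μ' : Fin d), κ' ≠ μ' →
      ‖((hol (avgIter L U₀ j) x (plaqWord κ' μ') : (Matrix (Fin N) (Fin N) ℂ)ˣ) : Matrix (Fin N) (Fin N) ℂ) - 1‖ ≤ a j)
    (hμ72 : ∀ j < k, 72 * μ j ≤ 1)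
    (Yt : ℕ → Site d → Fin d → Matrix (Fin N) (Fin N) ℂ)
    (hYt : ∀ (i : ℕ) (x : Site d) (μ' : Fin d), Yt i x μ' = ((tildIter L U₀ U₁ i x μ' : (Matrix (Fin N) (Fin N) ℂ)ˣ) : Matrix (Fin N) (Fin N) ℂ) - 1)
    (hμ : ∀ j < k, ∀ (z : Fin d → Fin (N' * L ^ (k - (j + 1)))) (κ : Fin d), (2 * d + 2) * L * Real.sqrt (∑ s : Fin d → Fin L, ∑ ν : Fin d,
      (‖Yt j ((L : ℤ) • boxVec (N' * L ^ (k - (j + 1))) z + boxVec L s) ν‖ ^ 2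
        + ‖Yt j ((L : ℤ) • boxVec (N' * L ^ (k - (j + 1))) z + (L : ℤ) • e κ + boxVec L s) ν‖ ^ 2)) ≤ μ j)
    (Glin Nn rem : ℕ → Site d → Fin d → Matrix (Fin N) (Fin N) ℂ) (Λ : ℕ → Site d → Matrix (Fin N) (Fin N) ℂ)
    (hrem : ∀ (j : ℕ) (z : Site d) (κ : Fin d), rem j z κ = Yt (j + 1) z κ
      - (fderiv ℂ (eml : ((Fin d → Fin L) → Matrix (Fin N) (Fin N) ℂ) → Matrix (Fin N) (Fin N) ℂ)
            (fun r => ((Wcx L (avgIter L U₀ j) ((L : ℤ) • z) κ (boxVec L r) : (Matrix (Fin N) (Fin N) ℂ)ˣ) : Matrix (Fin N) (Fin N) ℂ))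
            (fun r => tsum (avgIter L U₀ j) (Yt j) ((L : ℤ) • z) (gammaWord L κ (boxVec L r) ++ seg κ (-(L : ℤ)))
              * ((Wcx L (avgIter L U₀ j) ((L : ℤ) • z) κ (boxVec L r) : (Matrix (Fin N) (Fin N) ℂ)ˣ) : Matrix (Fin N) (Fin N) ℂ))
            * (((expUnit (Xavg L (avgIter L U₀ j) ((L : ℤ) • z) κ))⁻¹ : (Matrix (Fin N) (Fin N) ℂ)ˣ) : Matrix (Fin N) (Fin N) ℂ)
          + ((expUnit (Xavg L (avgIter L U₀ j) ((L : ℤ) • z) κ) : (Matrix (Fin N) (Fin N) ℂ)ˣ) : Matrix (Fin N) (Fin N) ℂ)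
            * tsum (avgIter L U₀ j) (Yt j) ((L : ℤ) • z) (seg κ (L : ℤ))
            * (((expUnit (Xavg L (avgIter L U₀ j) ((L : ℤ) • z) κ))⁻¹ : (Matrix (Fin N) (Fin N) ℂ)ˣ) : Matrix (Fin N) (Fin N) ℂ)))
    (hG0 : Glin 0 = Yt 0) (hN0 : Nn 0 = 0) (hΛ0 : ∀ z, Λ 0 z = 0)
    (hGlin : ∀ (j : ℕ) (z : Site d) (κ : Fin d), Glin (j + 1) z κ
      = (fderiv ℂ (eml : ((Fin d → Fin L) → Matrix (Fin N) (Fin N) ℂ) → Matrix (Fin N) (Fin N) ℂ)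
            (fun r => ((Wcx L (avgIter L U₀ j) ((L : ℤ) • z) κ (boxVec L r) : (Matrix (Fin N) (Fin N) ℂ)ˣ) : Matrix (Fin N) (Fin N) ℂ))
            (fun r => tsum (avgIter L U₀ j) (Glin j) ((L : ℤ) • z) (gammaWord L κ (boxVec L r) ++ seg κ (-(L : ℤ)))
              * ((Wcx L (avgIter L U₀ j) ((L : ℤ) • z) κ (boxVec L r) : (Matrix (Fin N) (Fin N) ℂ)ˣ) : Matrix (Fin N) (Fin N) ℂ))
            * (((expUnit (Xavg L (avgIter L U₀ j) ((L : ℤ) • z) κ))⁻¹ : (Matrix (Fin N) (Fin N) ℂ)ˣ) : Matrix (Fin N) (Fin N) ℂ)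
          + ((expUnit (Xavg L (avgIter L U₀ j) ((L : ℤ) • z) κ) : (Matrix (Fin N) (Fin N) ℂ)ˣ) : Matrix (Fin N) (Fin N) ℂ)
            * tsum (avgIter L U₀ j) (Glin j) ((L : ℤ) • z) (seg κ (L : ℤ))
            * (((expUnit (Xavg L (avgIter L U₀ j) ((L : ℤ) • z) κ))⁻¹ : (Matrix (Fin N) (Fin N) ℂ)ˣ) : Matrix (Fin N) (Fin N) ℂ))
        - (FhatCov L (avgIter L U₀ j) (Glin j) ((L : ℤ) • z)
            - conjR (avgIter L U₀ (j + 1) z κ) (FhatCov L (avgIter L U₀ j) (Glin j) ((L : ℤ) • (z + e κ)))))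
    (hNn : ∀ (j : ℕ) (z : Site d) (κ : Fin d), Nn (j + 1) z κ
      = (fderiv ℂ (eml : ((Fin d → Fin L) → Matrix (Fin N) (Fin N) ℂ) → Matrix (Fin N) (Fin N) ℂ)
            (fun r => ((Wcx L (avgIter L U₀ j) ((L : ℤ) • z) κ (boxVec L r) : (Matrix (Fin N) (Fin N) ℂ)ˣ) : Matrix (Fin N) (Fin N) ℂ))
            (fun r => tsum (avgIter L U₀ j) (Nn j) ((L : ℤ) • z) (gammaWord L κ (boxVec L r) ++ seg κ (-(L : ℤ)))
              * ((Wcx L (avgIter L U₀ j) ((L : ℤ) • z) κ (boxVec L r) : (Matrix (Fin N) (Fin N) ℂ)ˣ) : Matrix (Fin N) (Fin N) ℂ))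
            * (((expUnit (Xavg L (avgIter L U₀ j) ((L : ℤ) • z) κ))⁻¹ : (Matrix (Fin N) (Fin N) ℂ)ˣ) : Matrix (Fin N) (Fin N) ℂ)
          + ((expUnit (Xavg L (avgIter L U₀ j) ((L : ℤ) • z) κ) : (Matrix (Fin N) (Fin N) ℂ)ˣ) : Matrix (Fin N) (Fin N) ℂ)
            * tsum (avgIter L U₀ j) (Nn j) ((L : ℤ) • z) (seg κ (L : ℤ))
            * (((expUnit (Xavg L (avgIter L U₀ j) ((L : ℤ) • z) κ))⁻¹ : (Matrix (Fin N) (Fin N) ℂ)ˣ) : Matrix (Fin N) (Fin N) ℂ))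
        - (FhatCov L (avgIter L U₀ j) (Nn j) ((L : ℤ) • z)
            - conjR (avgIter L U₀ (j + 1) z κ) (FhatCov L (avgIter L U₀ j) (Nn j) ((L : ℤ) • (z + e κ))))
        + rem j z κ)
    (hΛs : ∀ (j : ℕ) (z : Site d), Λ (j + 1) z = FhatCov L (avgIter L U₀ j) (Glin j + Nn j) ((L : ℤ) • z) + Λ j ((L : ℤ) • z))
    (m n g lam : ℕ → ℝ)
    (hm : ∀ j, m j = Real.sqrt (∑ t : Fin d → Fin (N' * L ^ (k - j)), ∑ μ' : Fin d, ‖Glin j (boxVec (N' * L ^ (k - j)) t) μ'‖ ^ 2))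
    (hn : ∀ j, n j = Real.sqrt (∑ t : Fin d → Fin (N' * L ^ (k - j)), ∑ μ' : Fin d, ‖Nn j (boxVec (N' * L ^ (k - j)) t) μ'‖ ^ 2))
    (hg : ∀ j, g j = Real.sqrt (∑ t : Fin d → Fin (N' * L ^ (k - j)), ∑ κ : Fin d, ∑ ν : Fin d,
      ‖conjR (avgIter L U₀ j (boxVec (N' * L ^ (k - j)) t) ν) (Glin j (boxVec (N' * L ^ (k - j)) t + e ν) κ) - Glin j (boxVec (N' * L ^ (k - j)) t) κ‖ ^ 2))
    (hlam : ∀ j, lam j = Real.sqrt (∑ t : Fin d → Fin (N' * L ^ (k - j)), ∑ κ : Fin d,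
      ‖Λ j (boxVec (N' * L ^ (k - j)) t) - conjR (avgIter L U₀ j (boxVec (N' * L ^ (k - j)) t) κ) (Λ j (boxVec (N' * L ^ (k - j)) t + e κ))‖ ^ 2))
    {ρ wG wN wS : ℝ} (hwG : 0 ≤ wG) (hwN : 0 ≤ wN) (wM : ℕ → ℝ) (hwM0 : ∀ j, 0 ≤ wM j)
    (nC AC : ℕ) (hnC : L * L + L ≤ nC + 1) (hnA : nC + 1 ≤ AC * (L * L)) (hρs : Real.sqrt (L : ℝ) = ρ⁻¹)
    (hdomG : 2 * (3 * ((Real.sqrt L)⁻¹ * ((d : ℝ) * ((L : ℝ) ^ 2 / 4) * (2 * ((L : ℝ) ^ d)⁻¹ * (L : ℝ) * (L : ℝ)))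
              + (L : ℝ)⁻¹ * (2 * (d : ℝ) * (1 - (Real.sqrt L)⁻¹)⁻¹ * ((L : ℝ) ^ 2 / 4) * 2
                  * (((L : ℝ) ^ d)⁻¹ * (3 * N * ((nC : ℝ) + 1) ^ 2 * ((d : ℝ) * ((d : ℝ) * (AC : ℝ) ^ d)))))
              + (Real.sqrt L)⁻¹ * (2 * (1 - (Real.sqrt L)⁻¹)⁻¹ * 2 * (N / 2 * (d : ℝ) ^ 2 * ((L : ℝ) - 1) ^ 2 * (L : ℝ) ^ 2 * (d : ℝ))))) ≤ wG)
    (hdomN : 8 * (d : ℝ) * (3 * ((Real.sqrt L)⁻¹ * ((d : ℝ) * ((L : ℝ) ^ 2 / 4) * (2 * ((L : ℝ) ^ d)⁻¹ * (L : ℝ) * (L : ℝ)))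
              + (L : ℝ)⁻¹ * (2 * (d : ℝ) * (1 - (Real.sqrt L)⁻¹)⁻¹ * ((L : ℝ) ^ 2 / 4) * 2
                  * (((L : ℝ) ^ d)⁻¹ * (3 * N * ((nC : ℝ) + 1) ^ 2 * ((d : ℝ) * ((d : ℝ) * (AC : ℝ) ^ d)))))
              + (Real.sqrt L)⁻¹ * (2 * (1 - (Real.sqrt L)⁻¹)⁻¹ * 2 * (N / 2 * (d : ℝ) ^ 2 * ((L : ℝ) - 1) ^ 2 * (L : ℝ) ^ 2 * (d : ℝ))))) ≤ wN)
    (hdomM : ∀ i < k, 2 * (3 * ((Real.sqrt L)⁻¹ * ((d : ℝ) * ((L : ℝ) ^ 2 / 4)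
                * (2 * ((L : ℝ) ^ d)⁻¹ * (8 * (((d : ℝ) + 1) * (L : ℝ)) ^ 2 * a i + 8 * α i) ^ 2 * (d : ℝ)))
              + (L : ℝ)⁻¹ * (2 * (d : ℝ) * (1 - (Real.sqrt L)⁻¹)⁻¹ * ((L : ℝ) ^ 2 / 4) * 2
                  * (((L : ℝ) ^ d)⁻¹ * ((12 * N * ((nC : ℝ) + 1) ^ 2 * (d : ℝ) ^ 3 * (nC : ℝ) ^ 2 * a i ^ 2
                      + 3 * (2 * d * L * (4 * α i) + 2 * ((3 * d + 1) * nC : ℝ) ^ 2 * a i) ^ 2) * ((d : ℝ) * ((d : ℝ) * (AC : ℝ) ^ d)))))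
              + (Real.sqrt L)⁻¹ * (2 * (1 - (Real.sqrt L)⁻¹)⁻¹ * 2
                  * ((8 * (d : ℝ) ^ 6 * ((L : ℝ) - 1) ^ 6 + 2 * N * (d : ℝ) ^ 5 * ((L : ℝ) - 1) ^ 4 * (L : ℝ) ^ 2) * a i ^ 2 * (d : ℝ)))))
          + 4 * (3 * ((L : ℝ)⁻¹ * (2 * (d : ℝ) * (1 - (Real.sqrt L)⁻¹)⁻¹ * ((L : ℝ) ^ 2 / 4) * 2 * (3 * ((L : ℝ) ^ 2)⁻¹ * ((L : ℝ) ^ d)⁻¹ * (d : ℝ)))))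
              * ((210 * ((2 * d + 2) * L)) ^ 2 * α i ^ 2 * (2 * d)) ≤ wM i)
    (hdomS : 2 * (3 * ((L : ℝ)⁻¹ * (2 * (d : ℝ) * (1 - (Real.sqrt L)⁻¹)⁻¹ * ((L : ℝ) ^ 2 / 4) * 2 * (3 * ((L : ℝ) ^ 2)⁻¹ * ((L : ℝ) ^ d)⁻¹ * (d : ℝ))))) ≤ wS) :
    ∀ j ≤ k, lam j ^ 2 ≤ ∑ i ∈ Finset.range j, (ρ⁻¹) ^ (j - i) * (wG * g i ^ 2 + wN * n i ^ 2 + wM i * (m i ^ 2 + n i ^ 2)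
      + wS * (260 * μ i * ((2 * d + 2) * L) * Real.sqrt (2 * d)) ^ 2 * (m i + n i + lam i) ^ 2) := by
  -- `0 ≤ Δc` by hand (its text is read off `hdomS`; `positivity` on the written-out kernel coefficients is ≈ 25 000 heartbeats apiece)
  have hcL0 : 0 ≤ (1 - (Real.sqrt (L : ℝ))⁻¹)⁻¹ := cL_nonneg (by exact_mod_cast (show 1 < L by omega))
  have aux : ∀ {t w : ℝ}, 2 * t ≤ w → 0 ≤ t → 0 ≤ t := fun _ h => h
  have hΔc0 := aux hdomS (mul_nonneg (by norm_num) (mul_nonneg (by positivity)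
    (mul_nonneg (mul_nonneg (mul_nonneg (mul_nonneg (by positivity) hcL0) (by positivity)) (by norm_num)) (by positivity))))
  have hns : ∀ (x y : Matrix (Fin N) (Fin N) ℂ), ‖x + y‖ ^ 2 ≤ 2 * ‖x‖ ^ 2 + 2 * ‖y‖ ^ 2 := fun x y => by
    nlinarith [norm_add_le x y, norm_nonneg (x + y), norm_nonneg x, norm_nonneg y, sq_nonneg (‖x‖ - ‖y‖)]
  letI : CStarAlgebra (Matrix (Fin N) (Fin N) ℂ) := {}
  haveI : NeZero L := ⟨by omega⟩
  have hL1 : 1 ≤ L := by omega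
  haveI hNcI : ∀ j, NeZero (N' * L ^ (k - j)) := fun j => ⟨by positivity⟩
  have hNcs : ∀ j < k, N' * L ^ (k - j) = N' * L ^ (k - (j + 1)) * L := fun j hj => period_tower_step N' L k j hj
  -- periodicity of the level objects (✓F-8a, §1)
  have hVper : ∀ j ≤ k, IsPeriodic (N' * L ^ (k - j)) (avgIter L U₀ j) := fun j hj => avgIter_isPeriodic_level L N' k hU₀ hj
  have hYper : ∀ j ≤ k, IsPeriodic (N' * L ^ (k - j)) (Yt j) := fun j hj => tildField_isPeriodic L N' k hU₀ hU₁ Yt hYt hj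
  have hremper : ∀ j < k, IsPeriodic (N' * L ^ (k - (j + 1))) (rem j) := fun j hj =>
    rem_isPeriodic L (N' * L ^ (k - j)) (N' * L ^ (k - (j + 1))) (hNcs j hj) (avgIter L U₀ j) (hVper j hj.le) (Yt j) (Yt (j + 1))
      (hYper j hj.le) (hYper (j + 1) hj) (rem j) (hrem j)
  -- the full reduced family `G̃ = G^{lin} + N` obeys the sourced recursion and is periodic with `Λ` (✓F-8b-1)
  have hCM : ∀ (j : ℕ) (X X' : Site d → Fin d → Matrix (Fin N) (Fin N) ℂ) (y : Site d),
      (fun (j : ℕ) (X : Site d → Fin d → Matrix (Fin N) (Fin N) ℂ) (y : Site d) => FhatCov L (avgIter L U₀ j) X ((L : ℤ) • y)) j (X + X') y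
        = (fun (j : ℕ) (X : Site d → Fin d → Matrix (Fin N) (Fin N) ℂ) (y : Site d) => FhatCov L (avgIter L U₀ j) X ((L : ℤ) • y)) j X y
          + (fun (j : ℕ) (X : Site d → Fin d → Matrix (Fin N) (Fin N) ℂ) (y : Site d) => FhatCov L (avgIter L U₀ j) X ((L : ℤ) • y)) j X' y :=
    fun j X X' y => cornerCharge_add L U₀ j X X' y
  have hsplit := sourced_recursion_of_split L U₀ (fun j X y => FhatCov L (avgIter L U₀ j) X ((L : ℤ) • y)) hCM rem Glin Nn hGlin hNn
  beta_reduce at hsplit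
  have hGtper : ∀ j ≤ k, IsPeriodic (N' * L ^ (k - j)) (Glin j + Nn j) ∧ IsPeriodic (N' * L ^ (k - j)) (Λ j) := by
    refine isPeriodic_sourced_families L (fun j => N' * L ^ (k - j)) k (fun j hj => hNcs j hj) (avgIter L U₀) hVper rem hremper
      (fun j => Glin j + Nn j) Λ ?_ hΛ0 (fun j z κ => hsplit j z κ) hΛs
    show IsPeriodic (N' * L ^ (k - 0)) (Glin 0 + Nn 0)
    rw [hG0, hN0, add_zero]; exact hYper 0 (Nat.zero_le _)
  obtain ⟨Λl, hΛl0, hΛls⟩ := exists_gauge_family L (fun j X y => FhatCov L (avgIter L U₀ j) X ((L : ℤ) • y)) Glin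
  have hGlper : ∀ j ≤ k, IsPeriodic (N' * L ^ (k - j)) (Glin j) := fun j hj =>
    (isPeriodic_sourced_families L (fun j => N' * L ^ (k - j)) k (fun j hj => hNcs j hj) (avgIter L U₀) hVper (fun _ _ _ => 0)
      (fun _ _ _ _ => rfl) Glin Λl (by rw [hG0]; exact hYper 0 (Nat.zero_le _)) hΛl0 (fun j z κ => by rw [hGlin, add_zero]) hΛls j hj).1
  have hNper : ∀ j ≤ k, IsPeriodic (N' * L ^ (k - j)) (Nn j) := fun j hj => by
    intro x m'
    have h1 := (hGtper j hj).1 x m'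
    have h2 := hGlper j hj x m'
    simp only [Pi.add_apply] at h1 ⊢
    rw [h2] at h1
    exact add_left_cancel h1
  -- the structure identity `Ỹ_j = G̃_j + (Λ_j − Ad Λ_j)` (✓F-7a)
  have hW : ∀ j < k, ∀ (z : Site d) (κ : Fin d) (r : Fin d → Fin L),
      ‖((Wcx L (avgIter L U₀ j) ((L : ℤ) • z) κ (boxVec L r) : (Matrix (Fin N) (Fin N) ℂ)ˣ) : Matrix (Fin N) (Fin N) ℂ) - 1‖ < 1 :=
    fun j hj z κ r => (hα j hj z κ r).trans_lt (by linarith [hα24 j hj])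
  have hstruct := sourced_cornerComb_structure L U₀ k hW Yt rem (fun j z κ => by rw [hrem]; abel)
    (fun j X y => FhatCov L (avgIter L U₀ j) X ((L : ℤ) • y)) (fun j => Glin j + Nn j) Λ
    (by show Glin 0 + Nn 0 = Yt 0; rw [hG0, hN0, add_zero]) hΛ0 (fun j z κ => hsplit j z κ) hΛs
  -- the cell energies of the full family (opaque letters) and their rows (✓F-8b-2 v2)
  obtain ⟨Γ, hΓ⟩ : ∃ Γ : ℕ → ℝ, ∀ i, Γ i = ∑ y : Fin d → Fin (N' * L ^ (k - i)), ∑ μ' : Fin d, ∑ ν : Fin d,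
      ‖conjR (avgIter L U₀ i (boxVec (N' * L ^ (k - i)) y) ν) ((Glin i + Nn i) (boxVec (N' * L ^ (k - i)) y + e ν) μ')
        - (Glin i + Nn i) (boxVec (N' * L ^ (k - i)) y) μ'‖ ^ 2 := ⟨_, fun _ => rfl⟩
  obtain ⟨Μ, hΜ⟩ : ∃ Μ : ℕ → ℝ, ∀ i, Μ i = ∑ y : Fin d → Fin (N' * L ^ (k - i)), ∑ μ' : Fin d, ‖(Glin i + Nn i) (boxVec (N' * L ^ (k - i)) y) μ'‖ ^ 2 :=
    ⟨_, fun _ => rfl⟩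
  obtain ⟨Δ, hΔ⟩ : ∃ Δ : ℕ → ℝ, ∀ j, Δ j = ∑ μ' : Fin d, ∑ y : Fin d → Fin (N' * L ^ (k - (j + 1))),
      ‖(Glin (j + 1) + Nn (j + 1)) (boxVec (N' * L ^ (k - (j + 1))) y) μ'
        - ∑ r : Fin d → Fin L, ∑ t ∈ Finset.range L, (((L : ℝ) ^ d)⁻¹) •
            conjR (hol (avgIter L U₀ j) ((L : ℤ) • boxVec (N' * L ^ (k - (j + 1))) y) (treeWord (boxVec L r) ++ seg μ' (t : ℤ)))
              ((Glin j + Nn j) ((L : ℤ) • boxVec (N' * L ^ (k - (j + 1))) y + boxVec L r + (t : ℤ) • e μ') μ')‖ ^ 2 := ⟨_, fun _ => rfl⟩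
  obtain ⟨MY, hMY⟩ : ∃ MY : ℕ → ℝ, ∀ i, MY i = ∑ y : Fin d → Fin (N' * L ^ (k - i)), ∑ μ' : Fin d, ‖Yt i (boxVec (N' * L ^ (k - i)) y) μ'‖ ^ 2 :=
    ⟨_, fun _ => rfl⟩
  have hΓ0 : ∀ i, 0 ≤ Γ i := fun i => by rw [hΓ]; exact Finset.sum_nonneg fun _ _ => Finset.sum_nonneg fun _ _ => Finset.sum_nonneg fun _ _ => sq_nonneg _
  have hMY0 : ∀ i, 0 ≤ MY i := fun i => by rw [hMY]; exact Finset.sum_nonneg fun _ _ => Finset.sum_nonneg fun _ _ => sq_nonneg _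
  have hΜ0 : ∀ i, 0 ≤ Μ i := fun i => by rw [hΜ]; exact Finset.sum_nonneg fun _ _ => Finset.sum_nonneg fun _ _ => sq_nonneg _
  have hΔ0 : ∀ i, 0 ≤ Δ i := fun i => by rw [hΔ]; exact Finset.sum_nonneg fun _ _ => Finset.sum_nonneg fun _ _ => sq_nonneg _
  have hsq : ∀ {x s : ℝ}, x = Real.sqrt s → 0 ≤ s → x ^ 2 = s := fun h hs => by rw [h]; exact Real.sq_sqrt hs
  have hΓle : ∀ i < k, Γ i ≤ 2 * g i ^ 2 + 8 * d * n i ^ 2 := by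
    intro i hi
    rw [hsq (hg i) (Finset.sum_nonneg fun _ _ => Finset.sum_nonneg fun _ _ => Finset.sum_nonneg fun _ _ => sq_nonneg _), hsq (hn i) (Finset.sum_nonneg fun _ _ => Finset.sum_nonneg fun _ _ => sq_nonneg _), hΓ]
    exact sum_cell_covGrad_add_le (N' * L ^ (k - i)) (avgIter L U₀ i) (fun x μ' => unitaryUnits_le_U1 (hVu i hi.le x μ')) (Glin i) (Nn i)
      (fun x κ μ' => apply_add_period_of_isPeriodic (hNper i hi.le) x κ μ')
  have hΜle : ∀ i ≤ k, Μ i ≤ 2 * m i ^ 2 + 2 * n i ^ 2 := by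
    intro i hi
    rw [hsq (hm i) (Finset.sum_nonneg fun _ _ => Finset.sum_nonneg fun _ _ => sq_nonneg _), hsq (hn i) (Finset.sum_nonneg fun _ _ => Finset.sum_nonneg fun _ _ => sq_nonneg _), hΜ, Finset.mul_sum, Finset.mul_sum,
      ← Finset.sum_add_distrib]
    refine Finset.sum_le_sum fun y _ => ?_
    rw [Finset.mul_sum, Finset.mul_sum, ← Finset.sum_add_distrib]
    refine Finset.sum_le_sum fun μ' _ => ?_
    simp only [Pi.add_apply]
    exact hns _ _
  have hMYle : ∀ i ≤ k, MY i ≤ (m i + n i + lam i) ^ 2 := by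
    intro i hi
    have h := sqrt_mass_full_le (N' * L ^ (k - i)) (avgIter L U₀ i) (Yt i) (Glin i) (Nn i) (Λ i) (fun z κ => by
      have := hstruct i hi z κ; simp only [Pi.add_apply] at this; exact this)
    rw [← hm, ← hn, ← hlam, ← hMY] at h
    calc MY i = Real.sqrt (MY i) ^ 2 := (Real.sq_sqrt (hMY0 i)).symm
      _ ≤ (m i + n i + lam i) ^ 2 := pow_le_pow_left₀ (Real.sqrt_nonneg _) h 2
  have hΔle : ∀ i < k, Δ i ≤ 2 * ((210 * ((2 * d + 2) * L)) ^ 2 * α i ^ 2 * (2 * d) * Μ i)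
      + 2 * ((260 * μ i * ((2 * d + 2) * L) * Real.sqrt (2 * d)) ^ 2 * MY i) := by
    intro i hi
    have h5 := sum_cell_stepDefect_sq_le L (N' * L ^ (k - (i + 1))) hL1 U₀ U₁ i (hVu i hi.le) (hTu i hi) Yt hYt (Glin i + Nn i)
      (Glin (i + 1) + Nn (i + 1))
      (fun x κ μ' => by rw [← hNcs i hi]; exact apply_add_period_of_isPeriodic (hGtper i hi.le).1 x κ μ')
      (fun x κ μ' => by rw [← hNcs i hi]; exact apply_add_period_of_isPeriodic (hYper i hi.le) x κ μ')
      (hα24 i hi) (fun z κ r => hα i hi _ κ r) (hμ72 i hi) (hμ i hi) (rem i) (hrem i) (fun z κ => hsplit i z κ)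
    rw [sum_boxVec_congr (hNcs i hi).symm (fun x => ∑ ν : Fin d, ‖(Glin i + Nn i) x ν‖ ^ 2),
      sum_boxVec_congr (hNcs i hi).symm (fun x => ∑ ν : Fin d, ‖Yt i x ν‖ ^ 2), ← hΜ, ← hMY] at h5
    rw [hΔ]
    refine h5.trans (le_of_eq ?_)
    rw [mul_pow (260 * μ i * ((2 * d + 2) * L)) (Real.sqrt (2 * d)) 2, Real.sq_sqrt (by positivity)]
    ring
  -- ★ the case split on the level
  intro j hj
  cases j with
  | zero =>
    rw [Finset.range_zero, Finset.sum_empty, hlam]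
    have h0 : ∑ t : Fin d → Fin (N' * L ^ (k - 0)), ∑ κ : Fin d, ‖Λ 0 (boxVec (N' * L ^ (k - 0)) t)
        - conjR (avgIter L U₀ 0 (boxVec (N' * L ^ (k - 0)) t) κ) (Λ 0 (boxVec (N' * L ^ (k - 0)) t + e κ))‖ ^ 2 = 0 :=
      Finset.sum_eq_zero fun t _ => Finset.sum_eq_zero fun κ _ => by
        rw [hΛ0, hΛ0, B7Eq78Linearization.conjR_apply, mul_zero, zero_mul, sub_zero, norm_zero, zero_pow two_ne_zero]
    rw [h0, Real.sqrt_zero, zero_pow two_ne_zero]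
  | succ k' =>
    have hk : k' + 1 ≤ k := hj
    -- ✓F-8b-5b-0 (✓F-6d-3′ ∘ ✓F-8b-5a) at the tower
    have hf := gauge_row_folded L hL nC AC hnC hnA k' (N' * L ^ (k - (k' + 1))) (fun i => N' * L ^ (k - i))
      (fun i hi => by
        show N' * L ^ (k - i) = N' * L ^ (k - (k' + 1)) * L ^ (k' + 1 - i)
        rw [mul_assoc, ← pow_add]; congr 2; omega)
      (avgIter L U₀) (fun i hi x μ' => unitaryUnits_le_U1 (hVu i (by omega) x μ'))
      (fun i hi x μ' ι => apply_add_period_of_isPeriodic (hVper i (by omega)) x ι μ')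
      a ha0 (fun i hi x μ' ν hne => hplaq i (by omega) x μ' ν hne)
      (fun j => 4 * α j) (fun j => by have := hα0 j; positivity)
      (fun j hj' y ν => by
        rw [avgIter_succ, rescale_apply]
        exact norm_bavg_sub_straight_le L (fun x κ => unitaryUnits_le_U1 (hVu j (by omega) x κ)) ((L : ℤ) • y) ν
          (fun r => hα j (by omega) y ν r) (by linarith [hα24 j (by omega)]))
      α (fun z₀ κ r => hα k' (by omega) _ κ r) (by linarith [hα24 k' (by omega)])
      (fun z₀ κ => by
        have h := hVu (k' + 1) hk (boxVec (N' * L ^ (k - (k' + 1))) z₀) κ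
        rw [avgIter_succ, rescale_apply] at h
        exact unitaryUnits_le_U1 h)
      (fun i => Glin i + Nn i) (fun i hi x μ' ι => apply_add_period_of_isPeriodic (hGtper i (by omega)).1 x ι μ')
      Λ hΛ0 (fun i _ y => hΛs i y)
    beta_reduce at hf
    -- the rows in the written-out letters
    simp only [hΓ, hΜ, hΔ, hMY] at hΓ0 hΜ0 hΔ0 hMY0 hΓle hΜle hΔle hMYle
    -- the left-hand side is `λ_{k'+1}²`; the summands against the displayed row
    have hav : ∀ (x : Site d) (κ : Fin d), avgIter L U₀ (k' + 1) x κ = bavg L (avgIter L U₀ k') ((L : ℤ) • x) κ := fun x κ => by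
      rw [avgIter_succ, rescale_apply]
    rw [hlam]
    refine (Real.sq_sqrt (Finset.sum_nonneg fun _ _ => Finset.sum_nonneg fun _ _ => sq_nonneg _)).trans_le ?_
    simp only [hav]
    refine hf.trans (Finset.sum_le_sum fun i hi => ?_)
    have hik : i < k := by rw [Finset.mem_range] at hi; omega
    have hρpow : (ρ⁻¹) ^ (k' + 1 - i) = Real.sqrt (L : ℝ) ^ (k' + 1 - i) := by rw [hρs]
    refine (mul_le_mul_of_nonneg_left (summand_le hwG hwN (hwM0 i) hΔc0 (sq_nonneg _) (sq_nonneg _) (sq_nonneg _)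
      (hΓ0 i) (hΜ0 i) (hMY0 i) (hΓle i hik) (hΜle i hik.le) (hΔle i hik) (hMYle i hik.le)
      hdomG hdomN (hdomM i hik) hdomS) (pow_nonneg (Real.sqrt_nonneg _) _)).trans_eq ?_
    exact congrArg₂ (· * ·) hρpow.symm rfl

end Summit.QuantumFields.YangMills.Theorems.Prop7CornerCombGaugeRowInhabited

end
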